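import Literature.NumberTheory.ComplexMultiplication.FiniteQAlgebraLatticeWeakEquivalence
import HarnessLib

/-!
# LOCALISATION `ℤ ⇢ ℤ_(p)` of full lattices of an ARBITRARY finite-dimensional commutative `ℚ`-algebra `A`:
# `L = ⋂_p L_(p)`, only finitely many primes see a difference between two full lattices, prescribed local
# components GLUE to a unique full lattice, localisation commutes with products, colons and units, LOCALLY
# PRINCIPAL ⟹ INVERTIBLE and LOCALLY EQUIVALENT ⟹ WEAKLY EQUIVALENT (Hertling–Larabi 2026 §7: Def. 7.1,
# Thm. 7.2 (a)(b)(c) [Fa65, Fa64], Thm. 7.3 «⇐», Rem. 7.4 «⇐») — nilpotents allowed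

[topic NumberTheory/ComplexMultiplication] General-`A` series (namespace
`Literature.NumberTheory.ComplexMultiplication.FiniteQAlgebraLattice`), the general-`A` twin of the `Y = L_1 ⊕ ⋯ ⊕ L_t`
file `CMAlgebraLatticeLocalization` (seat p19 gen 32), whose proofs use nothing of `Y` beyond its ring structure;
sequel of `FiniteQAlgebraLatticePowersInvertible` §1 (THEOREM 7.2 (a) `L = ⋂_p L_(p)` for ANY `ℤ`-submodule:
`mem_of_forall_prime_exists_coprime_smul_mem`, REUSED, not restated) and of `FiniteQAlgebraLatticeWeakEquivalence`
(`eq_div_div_of_mul_eq_div_self`, `units_smul_mul`, `one_mem_div_mul_div_of_mul_eq_of_mul_eq`).  Lane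
`lit-hodgefound` (Track 2 foundations library), seat p19 generation 36, row g36-#6.  THEOREMS ONLY: no definition, no
instance, no notation, no named fact (D-0026, net Literature debt `0`), no `sorry`.  Fullness of lattices
(`IsFullLattice A M`: finitely generated and `ℚM = A`) enters only through `exists_smul_mem_of_fg` (a full lattice
absorbs a finitely generated one by a non-zero integer) and `isFullLattice_div`; everything else holds for
`ℤ`-submodules of any commutative ring.

DEF-FREE SPELLING.  `L_(p) := ℤ_(p)·L ⊂ A` is never introduced as an object; instead
* «`x ∈ L_(p)`» is written `∃ s : ℤ, ¬ ↑p ∣ s ∧ s • x ∈ L` (some integer prime to `p` multiplies `x` into `L`),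
* «`(L_1)_(p) = (L_2)_(p)`» — `L_1` AND `L_2` AGREE AT `p` — is written
  `∃ s : ℤ, ¬ ↑p ∣ s ∧ (∀ x ∈ L_1, s • x ∈ L_2) ∧ (∀ x ∈ L_2, s • x ∈ L_1)`
  (for finitely generated lattices the two spellings say the same: `exists_forall_smul_mem_iff_forall_exists`),
* «`L_(p) = a_pΛ_(p)`» is «`L` and `a_p • Λ` agree at `p`», «`L_(p)` is a principal `Λ_(p)`-ideal» is
  `∃ a : Aˣ, L and a • Λ agree at p`.

## Source, VERBATIM

C. Hertling, K. Larabi, *Semigroups from full lattices in commutative ℚ-algebras*, arXiv:2602.14973 (2026)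
[HertlingLarabi2026], held `paper:arxiv-2602.14973`, §7 (chunks p0018–p0019) — `A` «a finite dimensional
commutative ℚ-algebra with unit element» (Thm. 3.1), not assumed separable:
«**Definition 7.1.** […] (a) For `p ∈ ℙ` denote `ℤ_(p) := {a/b | a ∈ ℤ, b ∈ ℕ, gcd(a, b) = 1, gcd(p, b) = 1} ⊂ ℚ`.
It is a subring of `ℚ` and a local ring with maximal ideal `pℤ_(p)` and group of units `ℤ_(p)^{unit} = ℤ_(p) − pℤ_(p)`.
(b) Let `V` be an `n`-dimensional ℚ-vector space […] Let `L` be a full lattice in `V`. For `p ∈ ℙ` denote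
`L_(p) := ℤ_(p)·L := {qa | q ∈ ℤ_(p), a ∈ L} ⊂ V`. It is a free `ℤ_(p)`-module of rank `n` with
`L ⊂ L_(p) ⊂ ℚ·L_(p) = V`. The following basic facts are stated in [Fa65]. Part (c) is proved in [Fa64].
**Theorem 7.2.** Let `V` be an `n`-dimensional ℚ-vector space […] Let `L_1, L_2, L_3` and `L_4` be full lattices in
`V` […] (a) `L_1 = ⋂_{p∈ℙ} (L_1)_(p)` and for each `p ∈ ℙ` `(L_1 + L_2)_(p) = (L_1)_(p) + (L_2)_(p)`,
`(L_1 ∩ L_2)_(p) = (L_1)_(p) ∩ (L_2)_(p)`, `(L_1·L_2)_(p) = (L_1)_(p)·(L_2)_(p)` if `V = A` […],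
`(L_1:L_2)_(p) = (L_1)_(p):(L_2)_(p)` if `V = A` […]. (b) The subset of `ℙ` of elements `p` with `(L_1)_(p) ≠ (L_2)_(p)`
is finite. (c) [Fa65] [Fa64] For each `p ∈ ℙ` let `U_p ⊂ V` be a free `ℤ_(p)`-module of rank `n`. Suppose that
`U_p = (L_1)_(p)` for all except finitely many `p ∈ ℙ`. Then there is a unique full lattice `L` in `V` with `L_(p) = U_p`
for each `p ∈ ℙ`. By part (a) it is `L = ⋂_{p∈ℙ} U_p`. […] **Theorem 7.3** (Fa65). Let `A` be as in Theorem 3.1. Let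
the full lattice `L ∈ 𝓛(A)` have order `Λ := 𝒪(L)`. Then: `L` is invertible ⟺ `L_(p)` is a principal
`Λ_(p)`-ideal for each `p ∈ ℙ`, i.e. `L_(p) = a_pΛ_(p)` for some `a_p ∈ A^{unit}` for each `p ∈ ℙ`, with `a_p = 1_A`
for all except finitely many `p`. In fact, in [Fa65] only the more difficult implication ⇒ is proved. *Proof of the
implication ⇐:* Apply Theorem 7.2 (c) to `U_p := a_p⁻¹·Λ_(p)` for each `p ∈ ℙ`. It gives a full lattice `L̃` with
`(L̃)_(p) = a_p⁻¹·Λ_(p)` for each `p ∈ ℙ`, so `(L̃·L)_(p) = Λ_(p)` for each `p ∈ ℙ`, so `L̃·L = Λ`,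
`(Λ·L̃)_(p) = a_p⁻¹Λ_(p) = (L̃)_(p)` for each `p ∈ ℙ`, so `Λ·L̃ = L̃`, so `L` is invertible with `L⁻¹ = L̃`. □
**Remarks 7.4.** […] By Theorem 5.8 (a) two full lattices `L_1` and `L_2` are `w`-equivalent if and only if
`𝒪(L_1) = 𝒪(L_2)` and an invertible lattice `L_3 ∈ G(𝒪(L_1))` with `L_1L_3 = L_2` exists […]. By Theorem 7.3 this is
equivalent to `(L_2)_(p) = a_p·(L_1)_(p)` for each `p ∈ ℙ` with `a_p = 1_A` for almost all `p ∈ ℙ` and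
`a_p ∈ A^{unit}` for the other `p ∈ ℙ`. Lattices `L_1` and `L_2` with (7.3) are called locally equivalent. So, in
our commutative situation `w`-equivalence and local equivalence coincide [Fa65].»

## What is proved (`M, N, Λ, Lⱼ : Submodule ℤ A`; `p : ℕ` prime; `s • x`, `s : ℤ`; §1–§3 in any commutative ring,
## §4–§5 for a `ℚ`-algebra `A`)

* §1 «`x ∈ L_(p)`»: `exists_not_dvd_smul_mem_of_mem` (`L ⊆ L_(p)`), `exists_not_dvd_smul_add_mem`,
  `exists_not_dvd_smul_mem_of_smul_mem` (`L_(p)` is `p`-saturated); `exists_forall_smul_mem_iff_forall_exists` (for a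
  finitely generated `M`: `M ⊆ N_(p)` iff ONE `s` prime to `p` gives `sM ⊆ N`).
* §2 «`L_1` and `L_2` agree at `p`»: reflexive ∕ symmetric ∕ transitive (`locEq_refl`, `locEq_symm`, `locEq_trans`),
  THEOREM 7.2 (a) ∕ (c)-uniqueness **`eq_of_forall_prime_locEq`** (`(L_1)_(p) = (L_2)_(p)` for every prime
  `p ⟹ L_1 = L_2`), the (7.2 (a)) compatibilities `locEq_mul` (products), `locEq_div` (colons), `locEq_units_smul`
  (units), `locEq_iff_forall_mem_iff` (agreement at `p` ⟺ same `p`-local members, for finitely generated lattices).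
* §3 THEOREM 7.2 (b) **`finite_setOf_prime_not_locEq`**: two FULL lattices agree at all but finitely many primes.
* §4 THEOREM 7.2 (c) [Fa64] **`exists_isFullLattice_forall_prime_locEq`**: full lattices `U_p` prescribed at
  the primes of a finite set `P_0` (and `U_p = L_1` elsewhere) GLUE — there is a full lattice `L` agreeing with `U_p`
  at every prime `p` (namely `L = ⋂_p (U_p)_(p)`), unique by §2 (packaged form
  **`exists_unique_isFullLattice_forall_prime_locEq`**).
* §5 THEOREM 7.3 «⇐» **`mul_div_div_eq_of_forall_prime_locEq_units_smul`**: if `L_(p) = a_pΛ_(p)` (`Λ = 𝒪(L)`)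
  for every prime, `a_p = 1` off a finite set, then `L` is INVERTIBLE — with HL's inverse
  `exists_mul_eq_div_self_of_forall_prime_locEq_units_smul` (`L̃L = 𝒪(L)`, `𝒪(L)L̃ = L̃`, `L̃ = 𝒪(L):L`); and
  REMARK 7.4 «⇐» **`exists_mul_eq_of_forall_prime_locEq_units_smul`** (LOCALLY EQUIVALENT full lattices —
  `(L_2)_(p) = a_p(L_1)_(p)` — are WEAKLY EQUIVALENT: `L_1L_3 = L_2`, `L_2L_4 = L_1` with full `L_3, L_4`), hence
  `one_mem_div_mul_div_of_forall_prime_locEq_units_smul` (`1 ∈ (L_1:L_2)(L_2:L_1)`, Thm. 5.7 (a)).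
  NOT here: Thm. 7.2 (a) for `+` and `∩`, Thm. 7.2 (d), Thm. 7.3 «⇒» (invertible ⟹ locally principal, [Fa65]: the
  `Y`-file `CMAlgebraLatticeLocallyPrincipal`) and Lemma 7.5 ∕ Thm. 7.6.

## References
* [HertlingLarabi2026] C. Hertling, K. Larabi, arXiv:2602.14973 (2026), §7 Def. 7.1, Thm. 7.2, Thm. 7.3, Rem. 7.4
  (chunks p0018–p0019). [cite: HertlingLarabi2026, §7 Thm. 7.2, chunk p0018]
* [Faddeev1965] D. K. Faddeev, *Introduction to the multiplicative theory of modules of integral representations*,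
  Trudy Mat. Inst. Steklov 80 (1965) 145–182 (Russian; Proc. Steklov Inst. Math. 80 (1965) 164–210), cited as [Fa65]
  for Thm. 7.2 and Thm. 7.3; [Fa64] = D. K. Faddeev, *On the semigroup of genera in the theory of integer
  representations*, Izv. Akad. Nauk SSSR Ser. Mat. 28 (1964) 475–478, for Thm. 7.2 (c).
  [cite: Faddeev1965, as cited by HertlingLarabi2026 §7]
* [DadeTausskyZassenhaus1962] E. C. Dade, O. Taussky, H. Zassenhaus, Math. Ann. 148 (1962) 31–64 (localisation by
  prime ideals in the number-field case). [cite: DadeTausskyZassenhaus1962, §1]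
-/

noncomputable section

open scoped Pointwise
open Module

open Literature.NumberTheory.Automorphic (IsFullLattice mem_units_smul_submodule_iff exists_smul_mem_of_fg)

namespace Literature.NumberTheory.ComplexMultiplication.FiniteQAlgebraLattice

section Localization

variable {A : Type} [CommRing A] [Algebra ℚ A]

/-! ## §0 Primes of `ℤ` coming from `ℕ` (file-local bookkeeping) -/

/-- `p` prime ⟹ `↑p ∤ 1` in `ℤ` (file-local). [folklore] -/
private theorem not_dvd_one_int {p : ℕ} (hp : p.Prime) : ¬ (p : ℤ) ∣ 1 :=
  (Nat.prime_iff_prime_int.1 hp).not_dvd_one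

/-- `p ∤ s`, `p ∤ s′ ⟹ p ∤ ss′` in `ℤ` (file-local). [folklore] -/
private theorem not_dvd_mul_int {p : ℕ} (hp : p.Prime) {s s' : ℤ} (hs : ¬ (p : ℤ) ∣ s) (hs' : ¬ (p : ℤ) ∣ s') :
    ¬ (p : ℤ) ∣ s * s' :=
  fun h => ((Nat.prime_iff_prime_int.1 hp).dvd_or_dvd h).elim hs hs'

/-- `p ∤ s ⟹ p ∤ s^k` in `ℤ` (file-local). [folklore] -/
private theorem not_dvd_pow_int {p : ℕ} (hp : p.Prime) {s : ℤ} (hs : ¬ (p : ℤ) ∣ s) (k : ℕ) :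
    ¬ (p : ℤ) ∣ s ^ k := by
  induction k with
  | zero => rw [pow_zero]; exact not_dvd_one_int hp
  | succ k ih => rw [pow_succ]; exact not_dvd_mul_int hp ih hs

omit [Algebra ℚ A] in
/-- `(ss′) • (xy) = (s • x)(s′ • y)` (file-local). [folklore] -/
private theorem mul_smul_mul_smul (s s' : ℤ) (x y : A) : (s * s') • (x * y) = (s • x) * (s' • y) := by
  simp only [zsmul_eq_mul, Int.cast_mul]; ring

/-! ## §1 «`x ∈ L_(p)`»: the `p`-local members of a lattice -/

omit [Algebra ℚ A] in
/-- **`L ⊆ L_(p)`** («`L ⊂ L_(p) ⊂ ℚ·L_(p) = V`»). [cite: HertlingLarabi2026, §7 Def. 7.1 (b), chunk p0018] -/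
theorem exists_not_dvd_smul_mem_of_mem {p : ℕ} (hp : p.Prime) {M : Submodule ℤ A} {x : A}
    (hx : x ∈ M) : ∃ s : ℤ, ¬ (p : ℤ) ∣ s ∧ s • x ∈ M :=
  ⟨1, not_dvd_one_int hp, by rwa [one_smul]⟩

omit [Algebra ℚ A] in
/-- `L_(p)` is closed under addition (`ℤ_(p)·L` is a `ℤ_(p)`-module). [cite: HertlingLarabi2026, §7 Def. 7.1 (b), chunk p0018] -/
theorem exists_not_dvd_smul_add_mem {p : ℕ} (hp : p.Prime) {M : Submodule ℤ A} {x y : A}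
    (hx : ∃ s : ℤ, ¬ (p : ℤ) ∣ s ∧ s • x ∈ M) (hy : ∃ s : ℤ, ¬ (p : ℤ) ∣ s ∧ s • y ∈ M) :
    ∃ s : ℤ, ¬ (p : ℤ) ∣ s ∧ s • (x + y) ∈ M := by
  obtain ⟨s, hs, hsx⟩ := hx
  obtain ⟨s', hs', hsy⟩ := hy
  refine ⟨s * s', not_dvd_mul_int hp hs hs', ?_⟩
  rw [smul_add]
  refine M.add_mem ?_ ?_
  · rw [mul_comm, mul_smul]; exact M.smul_mem s' hsx
  · rw [mul_smul]; exact M.smul_mem s hsy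

omit [Algebra ℚ A] in
/-- **`L_(p)` is `p`-SATURATED: `s′ • x ∈ L_(p)` with `p ∤ s′` ⟹ `x ∈ L_(p)`** (the units `ℤ_(p) − pℤ_(p)` of the local
ring `ℤ_(p)`). [cite: HertlingLarabi2026, §7 Def. 7.1 (a)–(b), chunk p0018] -/
theorem exists_not_dvd_smul_mem_of_smul_mem {p : ℕ} (hp : p.Prime) {M : Submodule ℤ A} {x : A}
    {s' : ℤ} (hs' : ¬ (p : ℤ) ∣ s') (hx : ∃ s : ℤ, ¬ (p : ℤ) ∣ s ∧ s • (s' • x) ∈ M) :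
    ∃ s : ℤ, ¬ (p : ℤ) ∣ s ∧ s • x ∈ M := by
  obtain ⟨s, hs, hsx⟩ := hx
  exact ⟨s * s', not_dvd_mul_int hp hs hs', by rwa [mul_smul]⟩

/- THEOREM 7.2 (a) `L = ⋂_{p∈ℙ} L_(p)` itself — `x ∈ L` as soon as every prime `p` has an integer prime to `p`
multiplying `x` into `L`, for ANY `ℤ`-submodule — is `mem_of_forall_prime_exists_coprime_smul_mem` of
`FiniteQAlgebraLatticePowersInvertible` §1 (reused below, not restated). -/

omit [Algebra ℚ A] in
/-- **For a FINITELY GENERATED `M`: `M ⊆ N_(p)` iff ONE integer prime to `p` multiplies `M` into `N`** (the product of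
the multipliers of the generators). [cite: HertlingLarabi2026, §7 Def. 7.1 (b) («a free `ℤ_(p)`-module of rank `n`»), chunk p0018] -/
theorem exists_forall_smul_mem_iff_forall_exists {p : ℕ} (hp : p.Prime) {M N : Submodule ℤ A}
    (hM : M.FG) :
    (∃ s : ℤ, ¬ (p : ℤ) ∣ s ∧ ∀ x ∈ M, s • x ∈ N) ↔ ∀ x ∈ M, ∃ s : ℤ, ¬ (p : ℤ) ∣ s ∧ s • x ∈ N := by
  classical
  refine ⟨fun ⟨s, hs, h⟩ x hx => ⟨s, hs, h x hx⟩, fun h => ?_⟩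
  obtain ⟨G, hG⟩ := hM
  -- induction on the generating set
  suffices key : ∀ G' : Finset A, (↑G' : Set A) ⊆ ↑G →
      ∃ s : ℤ, ¬ (p : ℤ) ∣ s ∧ ∀ x ∈ Submodule.span ℤ (↑G' : Set A), s • x ∈ N by
    obtain ⟨s, hs, hsG⟩ := key G subset_rfl
    exact ⟨s, hs, fun x hx => hsG x (by rwa [hG])⟩
  intro G' hG'
  induction G' using Finset.induction_on with
  | empty => exact ⟨1, not_dvd_one_int hp, fun x hx => by
      rw [Finset.coe_empty, Submodule.span_empty, Submodule.mem_bot] at hx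
      rw [hx, smul_zero]; exact N.zero_mem⟩
  | insert a G'' ha ih =>
    obtain ⟨s, hs, hsG⟩ := ih ((Finset.coe_subset.2 (Finset.subset_insert a G'')).trans hG')
    have haM : a ∈ M := by
      rw [← hG]; exact Submodule.subset_span (hG' (Finset.mem_insert_self a G''))
    obtain ⟨s', hs', hsa⟩ := h a haM
    refine ⟨s' * s, not_dvd_mul_int hp hs' hs, fun x hx => ?_⟩
    rw [Finset.coe_insert, Submodule.mem_span_insert] at hx
    obtain ⟨k, z, hz, rfl⟩ := hx
    rw [smul_add]
    refine N.add_mem ?_ ?_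
    · have e : (s' * s) • (k • a) = (s * k) • (s' • a) := by rw [smul_smul, smul_smul]; congr 1; ring
      rw [e]; exact N.smul_mem _ hsa
    · rw [mul_smul]; exact N.smul_mem s' (hsG z hz)

/-! ## §2 «`L_1` and `L_2` agree at `p`»: an equivalence relation compatible with `𝓛(A)`'s operations -/

omit [Algebra ℚ A] in
/-- Agreement at `p` is REFLEXIVE. [cite: HertlingLarabi2026, §7 Thm. 7.2, chunk p0018] -/
theorem locEq_refl {p : ℕ} (hp : p.Prime) (M : Submodule ℤ A) :
    ∃ s : ℤ, ¬ (p : ℤ) ∣ s ∧ (∀ x ∈ M, s • x ∈ M) ∧ (∀ x ∈ M, s • x ∈ M) :=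
  ⟨1, not_dvd_one_int hp, fun x hx => by rwa [one_smul], fun x hx => by rwa [one_smul]⟩

omit [Algebra ℚ A] in
/-- Agreement at `p` is SYMMETRIC. [cite: HertlingLarabi2026, §7 Thm. 7.2, chunk p0018] -/
theorem locEq_symm {p : ℕ} {M N : Submodule ℤ A}
    (h : ∃ s : ℤ, ¬ (p : ℤ) ∣ s ∧ (∀ x ∈ M, s • x ∈ N) ∧ (∀ x ∈ N, s • x ∈ M)) :
    ∃ s : ℤ, ¬ (p : ℤ) ∣ s ∧ (∀ x ∈ N, s • x ∈ M) ∧ (∀ x ∈ M, s • x ∈ N) := by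
  obtain ⟨s, hs, h₁, h₂⟩ := h
  exact ⟨s, hs, h₂, h₁⟩

omit [Algebra ℚ A] in
/-- Agreement at `p` is TRANSITIVE. [cite: HertlingLarabi2026, §7 Thm. 7.2, chunk p0018] -/
theorem locEq_trans {p : ℕ} (hp : p.Prime) {M N P : Submodule ℤ A}
    (hMN : ∃ s : ℤ, ¬ (p : ℤ) ∣ s ∧ (∀ x ∈ M, s • x ∈ N) ∧ (∀ x ∈ N, s • x ∈ M))
    (hNP : ∃ s : ℤ, ¬ (p : ℤ) ∣ s ∧ (∀ x ∈ N, s • x ∈ P) ∧ (∀ x ∈ P, s • x ∈ N)) :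
    ∃ s : ℤ, ¬ (p : ℤ) ∣ s ∧ (∀ x ∈ M, s • x ∈ P) ∧ (∀ x ∈ P, s • x ∈ M) := by
  obtain ⟨s, hs, h₁, h₂⟩ := hMN
  obtain ⟨s', hs', h₃, h₄⟩ := hNP
  refine ⟨s' * s, not_dvd_mul_int hp hs' hs, fun x hx => ?_, fun x hx => ?_⟩
  · rw [mul_smul]; exact h₃ _ (h₁ x hx)
  · rw [mul_comm, mul_smul]; exact h₂ _ (h₄ x hx)

omit [Algebra ℚ A] in
/-- **THEOREM 7.2 (a) ∕ the uniqueness in (c): two lattices that agree at EVERY prime are EQUAL** (`L = ⋂_p L_(p)`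
on both sides). [cite: HertlingLarabi2026, §7 Thm. 7.2 (a), (c), chunk p0018] [cite: Faddeev1965, as cited by HertlingLarabi2026 §7] -/
theorem eq_of_forall_prime_locEq {M N : Submodule ℤ A}
    (h : ∀ p : ℕ, p.Prime → ∃ s : ℤ, ¬ (p : ℤ) ∣ s ∧ (∀ x ∈ M, s • x ∈ N) ∧ (∀ x ∈ N, s • x ∈ M)) : M = N := by
  refine le_antisymm (fun x hx => ?_) (fun x hx => ?_)
  · exact mem_of_forall_prime_exists_coprime_smul_mem fun p hp => by
      obtain ⟨s, hs, h₁, -⟩ := h p hp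
      exact ⟨s, hs, h₁ x hx⟩
  · exact mem_of_forall_prime_exists_coprime_smul_mem fun p hp => by
      obtain ⟨s, hs, -, h₂⟩ := h p hp
      exact ⟨s, hs, h₂ x hx⟩

omit [Algebra ℚ A] in
/-- **THEOREM 7.2 (a): `(L_1·L_2)_(p) = (L_1)_(p)·(L_2)_(p)`** — agreement at `p` is compatible with PRODUCTS.
[cite: HertlingLarabi2026, §7 Thm. 7.2 (a), chunk p0018] -/
theorem locEq_mul {p : ℕ} (hp : p.Prime) {M M' N N' : Submodule ℤ A}
    (hM : ∃ s : ℤ, ¬ (p : ℤ) ∣ s ∧ (∀ x ∈ M, s • x ∈ M') ∧ (∀ x ∈ M', s • x ∈ M))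
    (hN : ∃ s : ℤ, ¬ (p : ℤ) ∣ s ∧ (∀ x ∈ N, s • x ∈ N') ∧ (∀ x ∈ N', s • x ∈ N)) :
    ∃ s : ℤ, ¬ (p : ℤ) ∣ s ∧ (∀ x ∈ M * N, s • x ∈ M' * N') ∧ (∀ x ∈ M' * N', s • x ∈ M * N) := by
  obtain ⟨s, hs, h₁, h₂⟩ := hM
  obtain ⟨s', hs', h₃, h₄⟩ := hN
  refine ⟨s * s', not_dvd_mul_int hp hs hs', fun x hx => ?_, fun x hx => ?_⟩
  · refine Submodule.mul_induction_on hx (fun m hm n hn => ?_) (fun a b ha hb => ?_)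
    · rw [mul_smul_mul_smul]; exact Submodule.mul_mem_mul (h₁ m hm) (h₃ n hn)
    · rw [smul_add]; exact Submodule.add_mem _ ha hb
  · refine Submodule.mul_induction_on hx (fun m hm n hn => ?_) (fun a b ha hb => ?_)
    · rw [mul_smul_mul_smul]; exact Submodule.mul_mem_mul (h₂ m hm) (h₄ n hn)
    · rw [smul_add]; exact Submodule.add_mem _ ha hb

omit [Algebra ℚ A] in
/-- **THEOREM 7.2 (a): `(L_1:L_2)_(p) = (L_1)_(p):(L_2)_(p)`** — agreement at `p` is compatible with COLONS
(`(ss′x)y = s(x(s′y))`; no finiteness hypothesis in this spelling). [cite: HertlingLarabi2026, §7 Thm. 7.2 (a), chunk p0018] -/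
theorem locEq_div {p : ℕ} (hp : p.Prime) {M M' N N' : Submodule ℤ A}
    (hM : ∃ s : ℤ, ¬ (p : ℤ) ∣ s ∧ (∀ x ∈ M, s • x ∈ M') ∧ (∀ x ∈ M', s • x ∈ M))
    (hN : ∃ s : ℤ, ¬ (p : ℤ) ∣ s ∧ (∀ x ∈ N, s • x ∈ N') ∧ (∀ x ∈ N', s • x ∈ N)) :
    ∃ s : ℤ, ¬ (p : ℤ) ∣ s ∧ (∀ x ∈ M / N, s • x ∈ M' / N') ∧ (∀ x ∈ M' / N', s • x ∈ M / N) := by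
  obtain ⟨s, hs, h₁, h₂⟩ := hM
  obtain ⟨s', hs', h₃, h₄⟩ := hN
  refine ⟨s * s', not_dvd_mul_int hp hs hs', fun x hx => ?_, fun x hx => ?_⟩
  · rw [Submodule.mem_div_iff_forall_mul_mem] at hx ⊢
    intro y hy
    have e : (s * s') • x * y = s • (x * (s' • y)) := by simp only [zsmul_eq_mul, Int.cast_mul]; ring
    rw [e]
    exact h₁ _ (hx _ (h₄ y hy))
  · rw [Submodule.mem_div_iff_forall_mul_mem] at hx ⊢
    intro y hy
    have e : (s * s') • x * y = s • (x * (s' • y)) := by simp only [zsmul_eq_mul, Int.cast_mul]; ring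
    rw [e]
    exact h₂ _ (hx _ (h₃ y hy))

omit [Algebra ℚ A] in
/-- Agreement at `p` is compatible with the action of the UNITS of `A` (`(aL)_(p) = a·L_(p)`).
[cite: HertlingLarabi2026, §7 Thm. 7.3 («`L_(p) = a_pΛ_(p)`»), chunk p0018] -/
theorem locEq_units_smul {p : ℕ} (u : Aˣ) {M N : Submodule ℤ A}
    (h : ∃ s : ℤ, ¬ (p : ℤ) ∣ s ∧ (∀ x ∈ M, s • x ∈ N) ∧ (∀ x ∈ N, s • x ∈ M)) :
    ∃ s : ℤ, ¬ (p : ℤ) ∣ s ∧ (∀ x ∈ u • M, s • x ∈ u • N) ∧ (∀ x ∈ u • N, s • x ∈ u • M) := by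
  obtain ⟨s, hs, h₁, h₂⟩ := h
  have e : ∀ x : A, (u⁻¹ : Aˣ) • (s • x) = s • ((u⁻¹ : Aˣ) • x) := fun x => by
    simp only [Units.smul_def, smul_eq_mul, zsmul_eq_mul]; ring
  refine ⟨s, hs, fun x hx => ?_, fun x hx => ?_⟩
  · rw [mem_units_smul_submodule_iff] at hx ⊢
    rw [e]; exact h₁ _ hx
  · rw [mem_units_smul_submodule_iff] at hx ⊢
    rw [e]; exact h₂ _ hx

omit [Algebra ℚ A] in
/-- **The two spellings agree: finitely generated `L_1`, `L_2` agree at `p` iff they have the same `p`-local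
members, `(L_1)_(p) = (L_2)_(p)` elementwise.** [cite: HertlingLarabi2026, §7 Def. 7.1 (b), Thm. 7.2, chunk p0018] -/
theorem locEq_iff_forall_mem_iff {p : ℕ} (hp : p.Prime) {M N : Submodule ℤ A} (hM : M.FG) (hN : N.FG) :
    (∃ s : ℤ, ¬ (p : ℤ) ∣ s ∧ (∀ x ∈ M, s • x ∈ N) ∧ (∀ x ∈ N, s • x ∈ M)) ↔
      ∀ x : A, (∃ s : ℤ, ¬ (p : ℤ) ∣ s ∧ s • x ∈ M) ↔ (∃ s : ℤ, ¬ (p : ℤ) ∣ s ∧ s • x ∈ N) := by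
  constructor
  · rintro ⟨s, hs, h₁, h₂⟩ x
    exact ⟨fun ⟨s', hs', hx⟩ => ⟨s * s', not_dvd_mul_int hp hs hs', by rw [mul_smul]; exact h₁ _ hx⟩,
      fun ⟨s', hs', hx⟩ => ⟨s * s', not_dvd_mul_int hp hs hs', by rw [mul_smul]; exact h₂ _ hx⟩⟩
  · intro h
    obtain ⟨s, hs, hsM⟩ := (exists_forall_smul_mem_iff_forall_exists hp hM).2
      fun x hx => (h x).1 (exists_not_dvd_smul_mem_of_mem hp hx)
    obtain ⟨s', hs', hsN⟩ := (exists_forall_smul_mem_iff_forall_exists hp hN).2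
      fun x hx => (h x).2 (exists_not_dvd_smul_mem_of_mem hp hx)
    refine ⟨s * s', not_dvd_mul_int hp hs hs', fun x hx => ?_, fun x hx => ?_⟩
    · rw [mul_comm, mul_smul]; exact N.smul_mem _ (hsM x hx)
    · rw [mul_smul]; exact M.smul_mem _ (hsN x hx)

/-! ## §3 Theorem 7.2 (b): only finitely many primes distinguish two full lattices -/

omit [Algebra ℚ A] in
/-- A full lattice absorbs a finitely generated one by a NON-ZERO INTEGER, written with `ℤ`-scalars (the tree's
`exists_smul_mem_of_fg`). [cite: HertlingLarabi2026, §7 Thm. 7.2 (b), chunk p0018] -/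
private theorem exists_ne_zero_forall_smul_mem {M N : Submodule ℤ A}
    (hN : IsFullLattice A N) (hM : M.FG) : ∃ n : ℤ, n ≠ 0 ∧ ∀ x ∈ M, n • x ∈ N :=
  exists_smul_mem_of_fg hN hM

omit [Algebra ℚ A] in
/-- **THEOREM 7.2 (b): for FULL lattices `L_1`, `L_2` the set of primes `p` with `(L_1)_(p) ≠ (L_2)_(p)` is FINITE**
— it lies among the prime divisors of `nm`, where `nL_1 ⊆ L_2` and `mL_2 ⊆ L_1`.
[cite: HertlingLarabi2026, §7 Thm. 7.2 (b), chunk p0018] [cite: Faddeev1965, as cited by HertlingLarabi2026 §7] -/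
theorem finite_setOf_prime_not_locEq {M N : Submodule ℤ A} (hM : IsFullLattice A M)
    (hN : IsFullLattice A N) :
    {p : ℕ | p.Prime ∧ ¬ ∃ s : ℤ, ¬ (p : ℤ) ∣ s ∧ (∀ x ∈ M, s • x ∈ N) ∧ (∀ x ∈ N, s • x ∈ M)}.Finite := by
  obtain ⟨n, hn, hnM⟩ := exists_ne_zero_forall_smul_mem hN hM.1
  obtain ⟨m, hm, hmN⟩ := exists_ne_zero_forall_smul_mem hM hN.1
  refine ((n * m).natAbs.primeFactors.finite_toSet).subset fun p ⟨hp, hne⟩ => ?_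
  rw [Finset.mem_coe, Nat.mem_primeFactors]
  refine ⟨hp, ?_, Int.natAbs_ne_zero.2 (mul_ne_zero hn hm)⟩
  by_contra hpd
  refine hne ⟨n * m, fun h => hpd (Int.natCast_dvd.1 h), fun x hx => ?_, fun x hx => ?_⟩
  · rw [mul_comm, mul_smul]; exact N.smul_mem _ (hnM x hx)
  · rw [mul_smul]; exact M.smul_mem _ (hmN x hx)

/-! ## §4 Theorem 7.2 (c) [Fa64]: gluing prescribed local components -/

omit [Algebra ℚ A] in
/-- ONE non-zero integer comparing `L_1` with all the prescribed lattices `U_p`, `p ∈ P_0` (file-local step of the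
gluing). [cite: HertlingLarabi2026, §7 Thm. 7.2 (c), chunk p0018] -/
private theorem exists_ne_zero_forall_mem_finset {L₁ : Submodule ℤ A} (hL₁ : IsFullLattice A L₁)
    {U : ℕ → Submodule ℤ A} (hU : ∀ p, IsFullLattice A (U p)) (P₀ : Finset ℕ) :
    ∃ n : ℤ, n ≠ 0 ∧ ∀ p ∈ P₀, (∀ x ∈ U p, n • x ∈ L₁) ∧ (∀ x ∈ L₁, n • x ∈ U p) := by
  induction P₀ using Finset.induction_on with
  | empty => exact ⟨1, one_ne_zero, fun p hp => by simp at hp⟩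
  | insert a s ha ih =>
    obtain ⟨n, hn, hns⟩ := ih
    obtain ⟨n₁, hn₁, h₁⟩ := exists_ne_zero_forall_smul_mem hL₁ (hU a).1
    obtain ⟨n₂, hn₂, h₂⟩ := exists_ne_zero_forall_smul_mem (hU a) hL₁.1
    refine ⟨n * (n₁ * n₂), mul_ne_zero hn (mul_ne_zero hn₁ hn₂), fun p hp => ?_⟩
    rw [Finset.mem_insert] at hp
    rcases hp with hp | hp
    · rw [hp]
      refine ⟨fun x hx => ?_, fun x hx => ?_⟩
      · have e : (n * (n₁ * n₂)) • x = (n * n₂) • (n₁ • x) := by rw [smul_smul]; congr 1; ring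
        rw [e]; exact Submodule.smul_mem _ _ (h₁ x hx)
      · have e : (n * (n₁ * n₂)) • x = (n * n₁) • (n₂ • x) := by rw [smul_smul]; congr 1; ring
        rw [e]; exact Submodule.smul_mem _ _ (h₂ x hx)
    · refine ⟨fun x hx => ?_, fun x hx => ?_⟩
      · rw [mul_comm, mul_smul]; exact Submodule.smul_mem _ _ ((hns p hp).1 x hx)
      · rw [mul_comm, mul_smul]; exact Submodule.smul_mem _ _ ((hns p hp).2 x hx)

/-- **THEOREM 7.2 (c) [Fa65, Fa64], GLUING: given a full lattice `L_1`, a finite set `P_0` of primes and full lattices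
`U_p` with `U_p = L_1` for `p ∉ P_0`, there is a FULL lattice `L` which agrees with `U_p` at EVERY prime `p`** —
namely `L = ⋂_{p∈ℙ} (U_p)_(p) = {x | x ∈ (U_p)_(p) for all p}`: it contains `nL_1` and lies in `n⁻¹L_1` (both by
the local-global principle of 7.2 (a)), so it is full; at `p` it agrees with `U_p` (for `x ∈ U_p` with `dx ∈ L_1`,
`d = p^ad′`, `n = p^bn′`: `n′d′x ∈ L`). Unique by `eq_of_forall_prime_locEq`.
[cite: HertlingLarabi2026, §7 Thm. 7.2 (c), chunk p0018] [cite: Faddeev1965, as cited by HertlingLarabi2026 §7] -/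
theorem exists_isFullLattice_forall_prime_locEq {L₁ : Submodule ℤ A} (hL₁ : IsFullLattice A L₁)
    {U : ℕ → Submodule ℤ A} (hU : ∀ p, IsFullLattice A (U p)) (P₀ : Finset ℕ)
    (hU₁ : ∀ p ∉ P₀, U p = L₁) :
    ∃ M : Submodule ℤ A, IsFullLattice A M ∧
      ∀ p : ℕ, p.Prime → ∃ s : ℤ, ¬ (p : ℤ) ∣ s ∧ (∀ x ∈ M, s • x ∈ U p) ∧ (∀ x ∈ U p, s • x ∈ M) := by
  obtain ⟨n, hn, hnP⟩ := exists_ne_zero_forall_mem_finset hL₁ hU P₀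
  -- `nL_1 ⊆ U_p` and `nU_p ⊆ L_1` for EVERY `p` (outside `P_0` trivially)
  have hn₁ : ∀ p, ∀ x ∈ L₁, n • x ∈ U p := fun p x hx => by
    by_cases hp : p ∈ P₀
    · exact (hnP p hp).2 x hx
    · rw [hU₁ p hp]; exact L₁.smul_mem n hx
  have hn₂ : ∀ p, ∀ x ∈ U p, n • x ∈ L₁ := fun p x hx => by
    by_cases hp : p ∈ P₀
    · exact (hnP p hp).1 x hx
    · rw [hU₁ p hp] at hx; exact L₁.smul_mem n hx
  -- the glued lattice `⋂_p (U_p)_(p)`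
  let M : Submodule ℤ A :=
    { carrier := {x | ∀ p : ℕ, p.Prime → ∃ s : ℤ, ¬ (p : ℤ) ∣ s ∧ s • x ∈ U p}
      add_mem' := fun {x y} hx hy p hp => exists_not_dvd_smul_add_mem hp (hx p hp) (hy p hp)
      zero_mem' := fun p hp => ⟨1, not_dvd_one_int hp, by rw [smul_zero]; exact (U p).zero_mem⟩
      smul_mem' := fun k x hx p hp => by
        obtain ⟨s, hs, hsx⟩ := hx p hp
        exact ⟨s, hs, by rw [smul_comm]; exact (U p).smul_mem k hsx⟩ }
  have hM_mem : ∀ x, x ∈ M ↔ ∀ p : ℕ, p.Prime → ∃ s : ℤ, ¬ (p : ℤ) ∣ s ∧ s • x ∈ U p := fun x => Iff.rfl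
  -- `nL_1 ⊆ M`
  have hL₁M : ∀ x ∈ L₁, n • x ∈ M := fun x hx =>
    (hM_mem _).2 fun p hp => exists_not_dvd_smul_mem_of_mem hp (hn₁ p x hx)
  -- `nM ⊆ L_1`, by the local-global principle
  have hML₁ : ∀ x ∈ M, n • x ∈ L₁ := fun x hx =>
    mem_of_forall_prime_exists_coprime_smul_mem fun p hp => by
      obtain ⟨s, hs, hsx⟩ := (hM_mem x).1 hx p hp
      exact ⟨s, hs, by rw [smul_comm]; exact hn₂ p _ hsx⟩
  -- hence `M` is a full lattice
  have hnu : IsUnit (n • (1 : A)) := by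
    rw [zsmul_eq_mul, mul_one, ← map_intCast (algebraMap ℚ A) n]
    exact (((Int.cast_ne_zero (α := ℚ)).2 hn).isUnit).map _
  have hMfull : IsFullLattice A M := by
    refine ⟨?_, fun d => ?_⟩
    · have hle : M ≤ hnu.unit⁻¹ • L₁ := fun x hx => by
        rw [mem_units_smul_submodule_iff, inv_inv, Units.smul_def, IsUnit.unit_spec, smul_eq_mul, zsmul_eq_mul,
          mul_one, ← zsmul_eq_mul]
        exact hML₁ x hx
      refine Submodule.FG.of_le ?_ hle
      rw [Units.smul_def]
      exact hL₁.1.map _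
    · obtain ⟨k, hk, hkd⟩ := hL₁.2 d
      exact ⟨n * k, mul_ne_zero hn hk, by rw [mul_smul]; exact hL₁M _ hkd⟩
  refine ⟨M, hMfull, fun p hp => ?_⟩
  -- `M ⊆ (U_p)_(p)` uniformly (finite generation), and `U_p ⊆ M_(p)`
  obtain ⟨s, hs, hsM⟩ := (exists_forall_smul_mem_iff_forall_exists hp hMfull.1).2
    fun x hx => (hM_mem x).1 hx p hp
  -- `|n|L_1 ⊆ U_q` for every `q`
  have hN₁ : ∀ q, ∀ x ∈ L₁, (n.natAbs : ℤ) • x ∈ U q := fun q x hx => by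
    rcases Int.natAbs_eq n with h | h
    · rw [← h]; exact hn₁ q x hx
    · have h' : (n.natAbs : ℤ) = -n := by linarith
      rw [h', neg_smul]; exact (U q).neg_mem (hn₁ q x hx)
  -- decompose `|n| = p^b n′`
  obtain ⟨b, n', hn', hnn'⟩ := Nat.exists_eq_pow_mul_and_not_dvd (Int.natAbs_ne_zero.2 hn) p hp.ne_one
  have hn'int : ¬ (p : ℤ) ∣ (n' : ℤ) := fun h => hn' (Int.natCast_dvd_natCast.1 h)
  have hUM : ∀ x ∈ U p, ∃ s : ℤ, ¬ (p : ℤ) ∣ s ∧ s • x ∈ M := fun x hx => by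
    -- `Dx ∈ L_1` for a natural number `D = p^a d′ ≠ 0`
    obtain ⟨d, hd, hdx⟩ := hL₁.2 x
    have hDx : (d.natAbs : ℤ) • x ∈ L₁ := by
      rcases Int.natAbs_eq d with h | h
      · rw [← h]; exact hdx
      · have h' : (d.natAbs : ℤ) = -d := by linarith
        rw [h', neg_smul]; exact L₁.neg_mem hdx
    obtain ⟨a, d', hd', hdd'⟩ := Nat.exists_eq_pow_mul_and_not_dvd (Int.natAbs_ne_zero.2 hd) p hp.ne_one
    have hd'int : ¬ (p : ℤ) ∣ (d' : ℤ) := fun h => hd' (Int.natCast_dvd_natCast.1 h)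
    refine ⟨(n' : ℤ) * d', not_dvd_mul_int hp hn'int hd'int, (hM_mem _).2 fun q hq => ?_⟩
    by_cases hqp : q = p
    · exact ⟨1, not_dvd_one_int hq, by rw [one_smul, hqp]; exact (U p).smul_mem _ hx⟩
    · -- `p^{a+b}·(n′d′x) = |n|(|d|x) ∈ |n|L_1 ⊆ U_q`, and `q ∤ p^{a+b}`
      have hqpow : ¬ (q : ℤ) ∣ (p : ℤ) ^ (a + b) := by
        refine not_dvd_pow_int hq (fun h => hqp ?_) (a + b)
        exact (Nat.prime_dvd_prime_iff_eq hq hp).1 (Int.natCast_dvd_natCast.1 h)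
      refine ⟨(p : ℤ) ^ (a + b), hqpow, ?_⟩
      have key : ((p : ℤ) ^ (a + b)) • (((n' : ℤ) * d') • x) = (n.natAbs : ℤ) • ((d.natAbs : ℤ) • x) := by
        rw [smul_smul, smul_smul, hnn', hdd']
        push_cast
        congr 1
        ring
      rw [key]
      exact hN₁ q _ hDx
  obtain ⟨s', hs', hs'U⟩ := (exists_forall_smul_mem_iff_forall_exists hp (hU p).1).2 hUM
  exact ⟨s * s', not_dvd_mul_int hp hs hs', fun x hx => by rw [mul_comm, mul_smul]; exact (U p).smul_mem _ (hsM x hx),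
    fun x hx => by rw [mul_smul]; exact M.smul_mem _ (hs'U x hx)⟩

/-- **THEOREM 7.2 (c), with UNIQUENESS: exactly one full lattice has the prescribed local components.**
[cite: HertlingLarabi2026, §7 Thm. 7.2 (c), chunk p0018] [cite: Faddeev1965, as cited by HertlingLarabi2026 §7] -/
theorem exists_unique_isFullLattice_forall_prime_locEq {L₁ : Submodule ℤ A}
    (hL₁ : IsFullLattice A L₁) {U : ℕ → Submodule ℤ A}
    (hU : ∀ p, IsFullLattice A (U p)) (P₀ : Finset ℕ) (hU₁ : ∀ p ∉ P₀, U p = L₁) :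
    ∃! M : Submodule ℤ A, IsFullLattice A M ∧
      ∀ p : ℕ, p.Prime → ∃ s : ℤ, ¬ (p : ℤ) ∣ s ∧ (∀ x ∈ M, s • x ∈ U p) ∧ (∀ x ∈ U p, s • x ∈ M) := by
  obtain ⟨M, hM, hMU⟩ := exists_isFullLattice_forall_prime_locEq hL₁ hU P₀ hU₁
  refine ⟨M, ⟨hM, hMU⟩, fun M' ⟨_, hM'U⟩ => eq_of_forall_prime_locEq fun p hp => ?_⟩
  exact locEq_trans hp (hM'U p hp) (locEq_symm (hMU p hp))

/-! ## §5 Theorem 7.3 «⇐» (locally principal ⟹ invertible) and Remark 7.4 «⇐» (locally ⟹ weakly equivalent) -/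

/-- **THEOREM 7.3 «⇐», HL's proof: if `L_(p) = a_pΛ_(p)` for every prime `p` (`Λ = 𝒪(L)`, `a_p = 1` off a finite
set), then the full lattice `L̃` glued from `U_p := a_p⁻¹Λ` satisfies `L̃·L = 𝒪(L)` and `𝒪(L)·L̃ = L̃`, so
`L̃ = 𝒪(L):L`.** [cite: HertlingLarabi2026, §7 Thm. 7.3 (proof of ⇐), chunk p0018] -/
theorem exists_mul_eq_div_self_of_forall_prime_locEq_units_smul {M : Submodule ℤ A}
    (hM : IsFullLattice A M) (a : ℕ → Aˣ) (P₀ : Finset ℕ) (ha : ∀ p ∉ P₀, a p = 1)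
    (hloc : ∀ p : ℕ, p.Prime → ∃ s : ℤ, ¬ (p : ℤ) ∣ s ∧
      (∀ x ∈ M, s • x ∈ a p • (M / M)) ∧ (∀ x ∈ a p • (M / M), s • x ∈ M)) :
    ∃ N : Submodule ℤ A, IsFullLattice A N ∧ N * M = M / M ∧ (M / M) * N = N ∧
      N = (M / M) / M := by
  have hO : IsFullLattice A (M / M) := isFullLattice_div hM hM
  -- glue `L̃` from `U_p = a_p⁻¹ 𝒪(L)`
  obtain ⟨N, hN, hNU⟩ := exists_isFullLattice_forall_prime_locEq hO
    (U := fun p => (a p)⁻¹ • (M / M)) (fun p => IsFullLattice.units_smul _ hO) P₀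
    (fun p hp => by simp only [ha p hp, inv_one, one_smul])
  have hOO : (M / M) * (M / M) = M / M := div_self_mul_div_self M
  -- `(L̃L)_(p) = (a_p⁻¹Λ)(a_pΛ) = Λ` for every `p`, so `L̃L = Λ`
  have hNM : N * M = M / M := eq_of_forall_prime_locEq fun p hp => by
    have h := locEq_mul hp (hNU p hp) (hloc p hp)
    rwa [← units_smul_mul, mul_comm (M / M) (a p • (M / M)), ← units_smul_mul, inv_smul_smul, hOO] at h
  -- `(ΛL̃)_(p) = a_p⁻¹ΛΛ = (L̃)_(p)`, so `ΛL̃ = L̃`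
  have hON : (M / M) * N = N := eq_of_forall_prime_locEq fun p hp => by
    have h := locEq_mul hp (locEq_refl hp (M / M)) (hNU p hp)
    rw [mul_comm (M / M) ((a p)⁻¹ • (M / M)), ← units_smul_mul, hOO] at h
    exact locEq_trans hp h (locEq_symm (hNU p hp))
  exact ⟨N, hN, hNM, hON, eq_div_div_of_mul_eq_div_self (by rw [mul_comm, hNM]) hON⟩

/-- **THEOREM 7.3 «⇐» [Fa65]: LOCALLY PRINCIPAL ⟹ INVERTIBLE — if `L_(p) = a_pΛ_(p)` for every prime `p`
(`Λ = 𝒪(L)`; `a_p ∈ A^×`, `a_p = 1` for all but finitely many `p`), then `L·(𝒪(L):L) = 𝒪(L)`.**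
[cite: HertlingLarabi2026, §7 Thm. 7.3 ⇐, chunk p0018] [cite: Faddeev1965, as cited by HertlingLarabi2026 §7] -/
theorem mul_div_div_eq_of_forall_prime_locEq_units_smul {M : Submodule ℤ A}
    (hM : IsFullLattice A M) (a : ℕ → Aˣ) (P₀ : Finset ℕ) (ha : ∀ p ∉ P₀, a p = 1)
    (hloc : ∀ p : ℕ, p.Prime → ∃ s : ℤ, ¬ (p : ℤ) ∣ s ∧
      (∀ x ∈ M, s • x ∈ a p • (M / M)) ∧ (∀ x ∈ a p • (M / M), s • x ∈ M)) :
    M * ((M / M) / M) = M / M := by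
  obtain ⟨N, -, hNM, -, -⟩ := exists_mul_eq_div_self_of_forall_prime_locEq_units_smul hM a P₀ ha hloc
  exact mul_div_div_eq_of_exists_mul_eq_div_self ⟨N, by rw [mul_comm, hNM]⟩

/-- **REMARK 7.4 «⇐»: LOCALLY EQUIVALENT full lattices are WEAKLY EQUIVALENT** — if `(L_2)_(p) = a_p(L_1)_(p)` for
every prime `p` (`a_p = 1` off a finite set), then `L_1L_3 = L_2` and `L_2L_4 = L_1` for the full lattices `L_3`,
`L_4` glued from `a_p𝒪(L_1)` and `a_p⁻¹𝒪(L_1)` (`(L_1L_3)_(p) = a_p(L_1)_(p) = (L_2)_(p)`,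
`(L_2L_4)_(p) = a_pa_p⁻¹(L_1)_(p)`). [cite: HertlingLarabi2026, §7 Rem. 7.4 with Thm. 7.2 (c), chunks p0018–p0019] [cite: Faddeev1965, as cited by HertlingLarabi2026 §7 («local equivalence»)] -/
theorem exists_mul_eq_of_forall_prime_locEq_units_smul {L₁ L₂ : Submodule ℤ A}
    (hL₁ : IsFullLattice A L₁) (a : ℕ → Aˣ) (P₀ : Finset ℕ) (ha : ∀ p ∉ P₀, a p = 1)
    (hloc : ∀ p : ℕ, p.Prime → ∃ s : ℤ, ¬ (p : ℤ) ∣ s ∧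
      (∀ x ∈ L₂, s • x ∈ a p • L₁) ∧ (∀ x ∈ a p • L₁, s • x ∈ L₂)) :
    ∃ L₃ L₄ : Submodule ℤ A, IsFullLattice A L₃ ∧ IsFullLattice A L₄ ∧
      L₁ * L₃ = L₂ ∧ L₂ * L₄ = L₁ := by
  have hO : IsFullLattice A (L₁ / L₁) := isFullLattice_div hL₁ hL₁
  obtain ⟨L₃, hL₃, hL₃U⟩ := exists_isFullLattice_forall_prime_locEq hO
    (U := fun p => a p • (L₁ / L₁)) (fun p => IsFullLattice.units_smul _ hO) P₀
    (fun p hp => by simp only [ha p hp, one_smul])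
  obtain ⟨L₄, hL₄, hL₄U⟩ := exists_isFullLattice_forall_prime_locEq hO
    (U := fun p => (a p)⁻¹ • (L₁ / L₁)) (fun p => IsFullLattice.units_smul _ hO) P₀
    (fun p hp => by simp only [ha p hp, inv_one, one_smul])
  refine ⟨L₃, L₄, hL₃, hL₄, eq_of_forall_prime_locEq fun p hp => ?_, eq_of_forall_prime_locEq fun p hp => ?_⟩
  · -- `(L_1L_3)_(p) = L_1·a_p𝒪(L_1) = a_pL_1 = (L_2)_(p)`
    have h := locEq_mul hp (locEq_refl hp L₁) (hL₃U p hp)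
    rw [mul_comm L₁ (a p • (L₁ / L₁)), ← units_smul_mul, div_self_mul_eq_self] at h
    exact locEq_trans hp h (locEq_symm (hloc p hp))
  · -- `(L_2L_4)_(p) = a_pL_1·a_p⁻¹𝒪(L_1) = L_1`
    have h := locEq_mul hp (hloc p hp) (hL₄U p hp)
    rw [← units_smul_mul, mul_comm L₁ ((a p)⁻¹ • (L₁ / L₁)), ← units_smul_mul, smul_inv_smul,
      div_self_mul_eq_self] at h
    exact h

/-- **REMARK 7.4 «⇐» in the criterion of Thm. 5.7 (a): locally equivalent full lattices satisfy `1 ∈ (L_1:L_2)(L_2:L_1)`.**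
[cite: HertlingLarabi2026, §7 Rem. 7.4 and §5 Thm. 5.7 (a), chunks p0019, p0013] -/
theorem one_mem_div_mul_div_of_forall_prime_locEq_units_smul {L₁ L₂ : Submodule ℤ A}
    (hL₁ : IsFullLattice A L₁) (hL₂ : IsFullLattice A L₂) (a : ℕ → Aˣ)
    (P₀ : Finset ℕ) (ha : ∀ p ∉ P₀, a p = 1)
    (hloc : ∀ p : ℕ, p.Prime → ∃ s : ℤ, ¬ (p : ℤ) ∣ s ∧
      (∀ x ∈ L₂, s • x ∈ a p • L₁) ∧ (∀ x ∈ a p • L₁, s • x ∈ L₂)) :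
    (1 : A) ∈ (L₁ / L₂) * (L₂ / L₁) := by
  obtain ⟨L₃, L₄, -, -, h₃, h₄⟩ := exists_mul_eq_of_forall_prime_locEq_units_smul hL₁ a P₀ ha hloc
  exact one_mem_div_mul_div_of_mul_eq_of_mul_eq hL₂ h₃ h₄

end Localization

end Literature.NumberTheory.ComplexMultiplication.FiniteQAlgebraLattice
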